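import Summits.Ventures.LatticeQCDFlow.Scaling.ExactTransportBetweenSteps

/-!
# LatticeQCDFlow / Scaling — the expansion law BETWEEN COUPLINGS (file 2 of 2): an exact flow `μ_{β₀} → μ_β` must expand by `e^{c(β-β₀)-C}`

HONEST FRAMING: exact (Metropolis-corrected) sampling algorithms for lattice gauge theory; figures of merit are
autocorrelation/cost numbers at stated couplings and volumes; no continuum-physics claim.

Venture `LatticeQCDFlow` (cell pub-lqcd), topic `Scaling`, FANOUT row 29 (theory-2) — OUR WORK (THEORY-2.md §3.3
v2.7, "(C2a-E′) between couplings").  Items and inequalities: `Scaling/ExactTransportBetweenSteps.lean` (file 1).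

* `exactTransportExpansionBetween_of_ballVolumes` — `ExactTransportExpansionBetween d N G ρ` PROVED for every
  compact metric group with two-sided small-ball Haar volumes `a·r^κ ≤ Haar(B̄(g,r)) ≤ A·r^κ` (`κ ≥ 1`), every
  continuous `ρ` with `-N ≤ Re tr ρ ≤ N` and a non-constant character, `d ≥ 2`, with `c = 3s₀/(4κd)` (`s₀` the
  staircase constant of `extensive_action_of_nonconstant`) and `C = C₁/κ`, `C₁ = log(A/a) + log(1/a) +
  κ·log(1/r₀)` (`r₀` the uniform low-action radius of `exists_radius_action_le`).  At `β₀ = 0` it contains (C2a-E)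
  (`exactTransportExpansion_of_between`: at `β = 0` the Wilson weight is `1` and `Z = 1`, so `μ_{Λ,0}` is
  product Haar — the same three-line computation as the Yang–Mills tree's `BetaZeroClause.wilsonMeasure_zero`,
  which is not imported here to keep the venture's import cone inside `Literature` + `LatticeQCDFlow`).
* Mechanism (three volume-uniform inequalities, file 1): (1) STEP 1′ at EVERY `x`,
  `log Z_β - log Z_{β₀} + β·S(Tx) - β₀·S(x) ≤ #E·(log(A/a) + κ·log K)`; (2) the sublevel `Z`-ratio bound
  `log Z_β - log Z_{β₀} ≥ -(β-β₀)·s₀L^d/4 + #E·(log a + κ log r₀)` from the tree's low-action ball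
  `B̄(1,r₀) ⊆ {S ≤ s₀L^d/4}`; (3) the action attains its maximum `S_max ≥ s₀L^d` (compactness + the staircase
  configuration) and the image of `T` comes within any `η` of it (`μ_β` charges open sets), so at such an `x`:
  `β·S(Tx) - β₀·S(x) ≥ (β-β₀)·S_max - βη`.  Summing, the `L^d`'s match:
  `κ·d·L^d·log K ≥ (β-β₀)·(3/4)s₀L^d - d·L^d·C₁`.
* `layerExpansionDepthBetween_of_between`: the layer-depth form `n·log Λ ≥ c(β-β₀) - C`.
* Instances with NO hypothesis left (§4): `U1.exactTransportExpansionBetween d (2 ≤ d)`,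
  `UN.exactTransportExpansionBetween d N (2 ≤ d) (1 ≤ N)` (Hilbert–Schmidt metric),
  `SUN.exactTransportExpansionBetween d N (2 ≤ d) (2 ≤ N)` (`SU(3)`, `d = 4` included), `SUN.layerExpansionDepthBetween`.

Reading (THEORY-2 §5.11, barrier `TransportExpansionLaw`): the Lipschitz budget of an exact flow is charged per unit
of COUPLING WINDOW, not per unit of target coupling; a chain `0 = β₀ < β₁ < ⋯ < β_n = β` of exact stages has
`Σᵢ log Lip(Tᵢ) ≥ log Lip(T_n ∘ ⋯ ∘ T₁) ≥ cβ` by (C2a-E) anyway, so staging cannot beat the one-shot law; what the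
between-couplings law adds is the statement for flows whose INPUT is a thermalised `β₀`-ensemble obtained by other
means (HMC at `β₀`).  The additive constant `C` is an artefact of the non-asymptotic ball-volume constants `A/a`
and of the crude `Z`-ratio bound; the conjectured sharp form `κ·#E·log Lip(T) ≥ (β-β₀)·(S_max - ⟨S⟩_{β₀})` (no
constant; from exact small-ball asymptotics and Jensen) is NOT typed here.  Elementary given the tree; nothing here
is cited as a fact.
-/

noncomputable section

namespace Summit.Ventures.LatticeQCDFlow.Theory2.Lattice

open MeasureTheory Metric Set Literature.MathematicalPhysics.QuantumFieldTheory

/-! ## §2. The expansion law between couplings -/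

section Expansion

variable {N : ℕ} {G : Type} [Group G] [MetricSpace G] [IsTopologicalGroup G] [CompactSpace G]
  [SecondCountableTopology G] [MeasurableSpace G] [BorelSpace G]
  (ρ : G →* Matrix (Fin N) (Fin N) ℂ)

/-- **(C2a-E′) THE EXPANSION LAW BETWEEN COUPLINGS, PROVED** (OURS): two-sided ball volumes with exponent
`κ ≥ 1`, a continuous `ρ` with `-N ≤ Re tr ρ ≤ N` and a non-constant character, `d ≥ 2` ⟹
`ExactTransportExpansionBetween d N G ρ` with `c = 3s₀/(4κd)` and `C = C₁/κ`,
`C₁ = log(A/a) + log(1/a) + κ·log(1/r₀)`.  See the module docstring for the mechanism. [folklore] -/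
theorem exactTransportExpansionBetween_of_ballVolumes (d : ℕ) (hd : 2 ≤ d)
    (hρ : Continuous (ρ : G → Matrix (Fin N) (Fin N) ℂ))
    (htr : ∀ g, (ρ g).trace.re ≤ N) (htr' : ∀ g, -(N : ℝ) ≤ (ρ g).trace.re)
    (hnc : ∃ g : G, (ρ g).trace.re ≠ N)
    {κ : ℕ} (hκ : 0 < κ) {a A : ℝ} (ha : 0 < a)
    (hlo : ∀ (g : G) (r : ℝ), 0 < r → r ≤ 1 → a * r ^ κ ≤ (haarProbability G (closedBall g r)).toReal)
    (hup : ∀ (g : G) (r : ℝ), 0 < r → (haarProbability G (closedBall g r)).toReal ≤ A * r ^ κ) :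
    ExactTransportExpansionBetween d N G ρ := by
  obtain ⟨s₀, hs₀, hconf⟩ := extensive_action_of_nonconstant (d := d) ρ htr hnc hd
  have haA : a ≤ A := by
    have h1 := hlo 1 1 one_pos le_rfl
    have h2 := hup 1 1 one_pos
    rw [one_pow, mul_one] at h1 h2
    exact h1.trans h2
  have hA : 0 < A := ha.trans_le haA
  -- the uniform low-action radius
  set m : ℕ := Fintype.card {p : Fin d × Fin d // p.1 < p.2} with hm
  set η : ℝ := s₀ / (4 * ((m : ℝ) + 1)) with hηdef
  have hη : 0 < η := by positivity
  obtain ⟨r₀, hr₀, hr₀1, hball⟩ := exists_radius_action_le ρ hρ hη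
  set C₁ : ℝ := Real.log (A / a) - Real.log a - κ * Real.log r₀ with hC₁
  have hκr : (0 : ℝ) < κ := by exact_mod_cast hκ
  have hdr : (2 : ℝ) ≤ d := by exact_mod_cast hd
  have hd0 : (0 : ℝ) < d := by linarith
  refine ⟨3 * s₀ / (4 * κ * d), by positivity, C₁ / κ, fun L _ hL β₀ β hβ₀ hβ T K hT hmap => ?_⟩
  have hβ0 : 0 ≤ β := hβ₀.trans hβ
  have hL1 : (1 : ℝ) ≤ L := by exact_mod_cast (NeZero.one_le : 1 ≤ L)
  have hLd0 : (0 : ℝ) < (L : ℝ) ^ d := by positivity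
  set S : GaugeConfig d L G → ℝ := wilsonAction (d := d) (L := L) ρ with hSdef
  have hScont : Continuous S := continuous_wilsonAction (d := d) (L := L) ρ hρ
  have hTm : Measurable T := hT.continuous.measurable
  -- cardinalities
  have hEn : Fintype.card (Edge d L) = L ^ d * d := by simp [Fintype.card_prod, ZMod.card, Fintype.card_fin]
  have hE : (Fintype.card (Edge d L) : ℝ) = d * (L : ℝ) ^ d := by rw [hEn]; push_cast; ring
  have hPn : Fintype.card (Plaquette d L) = L ^ d * m := by
    rw [hm]; simp [Fintype.card_prod, ZMod.card, Fintype.card_fin]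
  have hP : (Fintype.card (Plaquette d L) : ℝ) = (L : ℝ) ^ d * m := by rw [hPn]; push_cast; ring
  -- low action on `B̄(1, r₀)`
  have hlow : ∀ U : GaugeConfig d L G, dist U 1 ≤ r₀ → S U ≤ s₀ * (L : ℝ) ^ d / 4 := by
    intro U hU
    have h := hball d L U hU
    rw [hP] at h
    calc S U ≤ η * ((L : ℝ) ^ d * m) := h
      _ ≤ η * ((L : ℝ) ^ d * (m + 1)) := by gcongr; linarith
      _ = s₀ * (L : ℝ) ^ d / 4 := by rw [hηdef]; field_simp
  -- the `Z`-ratio: `log Z_β - log Z_{β₀} ≥ -(β-β₀)s₀L^d/4 + #E(log a + κ log r₀)`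
  have hlogZ := log_partitionFunction_sub_ge ρ hρ htr hβ₀ hβ ha hlo hr₀ hr₀1 hlow
  -- the maximum of the action, `≥ s₀L^d`
  obtain ⟨xM, -, hxM⟩ :=
    isCompact_univ.exists_isMaxOn univ_nonempty (hScont.continuousOn (s := (univ : Set (GaugeConfig d L G))))
  have hSmax : ∀ U, S U ≤ S xM := fun U => (isMaxOn_iff.1 hxM) U (mem_univ U)
  obtain ⟨Vhi, hVhi⟩ := hconf L hL
  have hSM : s₀ * (L : ℝ) ^ d ≤ S xM := le_trans hVhi (hSmax Vhi)
  have hs₀L : 0 < s₀ * (L : ℝ) ^ d := by positivity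
  -- a high-action point and a low-action point in the image of `T`; `K > 0`
  obtain ⟨x₁, hx₁⟩ := exists_apply_mem_of_map_eq_between ρ htr htr' hβ0 hTm hmap
    (isOpen_lt continuous_const hScont : IsOpen {U | S xM - s₀ * (L : ℝ) ^ d / 2 < S U})
    ⟨xM, by show S xM - s₀ * (L : ℝ) ^ d / 2 < S xM; linarith⟩
  obtain ⟨x₀, hx₀⟩ := exists_apply_mem_of_map_eq_between ρ htr htr' hβ0 hTm hmap
    (isOpen_lt hScont continuous_const : IsOpen {U | S U < s₀ * (L : ℝ) ^ d / 2})
    ⟨1, by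
      show S 1 < s₀ * (L : ℝ) ^ d / 2
      have := hlow 1 (by rw [dist_self]; exact hr₀.le)
      linarith⟩
  have hx₁' : S xM - s₀ * (L : ℝ) ^ d / 2 < S (T x₁) := hx₁
  have hx₀' : S (T x₀) < s₀ * (L : ℝ) ^ d / 2 := hx₀
  have hK0 : 0 < (K : ℝ) := by
    have hne : T x₁ ≠ T x₀ := fun h => by rw [h] at hx₁'; linarith
    have h1 := hT.dist_le_mul x₁ x₀
    have hpos : 0 < dist (T x₁) (T x₀) := dist_pos.2 hne
    rcases K.coe_nonneg.eq_or_lt with h | h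
    · rw [← h, zero_mul] at h1; linarith
    · exact h
  -- STEP 1′ at image points `η`-close to the maximum, `η → 0`
  have hmain : (β - β₀) * (3 * (s₀ * (L : ℝ) ^ d) / 4) - Fintype.card (Edge d L) * C₁ ≤
      κ * Fintype.card (Edge d L) * Real.log K := by
    refine le_of_forall_pos_le_add fun ε hε => ?_
    have hθ : 0 < ε / (β + 1) := by positivity
    have hβθ : β * (ε / (β + 1)) ≤ ε := by
      rw [mul_div_assoc', div_le_iff₀ (by positivity)]; nlinarith
    obtain ⟨x, hx⟩ := exists_apply_mem_of_map_eq_between ρ htr htr' hβ0 hTm hmap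
      (isOpen_lt continuous_const hScont : IsOpen {U | S xM - ε / (β + 1) < S U})
      ⟨xM, by show S xM - ε / (β + 1) < S xM; linarith⟩
    have hx' : S xM - ε / (β + 1) < S (T x) := hx
    have h1 := log_partitionFunction_add_le_between ρ hρ htr ha hA hlo hup hβ₀ hβ0 hK0 hT hmap x
    have hp1 : β * (S xM - ε / (β + 1)) ≤ β * S (T x) := mul_le_mul_of_nonneg_left hx'.le hβ0
    have hp2 : β₀ * S x ≤ β₀ * S xM := mul_le_mul_of_nonneg_left (hSmax x) hβ₀
    have hp3 : (β - β₀) * (s₀ * (L : ℝ) ^ d) ≤ (β - β₀) * S xM :=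
      mul_le_mul_of_nonneg_left hSM (sub_nonneg.2 hβ)
    rw [hC₁]
    linarith [h1, hlogZ, hp1, hp2, hp3, hβθ]
  rw [hE] at hmain
  have hmain' : (β - β₀) * (3 * s₀ / 4) - d * C₁ ≤ κ * d * Real.log K := by
    refine le_of_not_gt fun hcon => ?_
    have := mul_lt_mul_of_pos_left hcon hLd0
    linarith
  have hkd : (0 : ℝ) < κ * d := by positivity
  have key : 3 * s₀ / (4 * κ * d) * (β - β₀) - C₁ / κ ≤ Real.log K := by
    have : 3 * s₀ / (4 * κ * d) * (β - β₀) - C₁ / κ = ((β - β₀) * (3 * s₀ / 4) - d * C₁) / (κ * d) := by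
      field_simp
    rw [this, div_le_iff₀ hkd]
    linarith
  calc Real.exp (3 * s₀ / (4 * κ * d) * (β - β₀) - C₁ / κ) ≤ Real.exp (Real.log K) := Real.exp_le_exp.2 key
    _ = K := Real.exp_log hK0

omit [SecondCountableTopology G] in
/-- **(C2a-E′) ⟹ (C2a-E)**: at `β₀ = 0` the prior is `Haar^{⊗E}` (weight `1`, `Z = 1`), and
`e^{cβ - C} ≥ e^{(c/2)β}` for `β ≥ 2|C|/c`. [folklore] -/
theorem exactTransportExpansion_of_between {d : ℕ} (h : ExactTransportExpansionBetween d N G ρ) :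
    ExactTransportExpansion d N G ρ := by
  obtain ⟨c, hc, C, hC⟩ := h
  refine ⟨c / 2, by positivity, 2 * |C| / c, fun L _ hL β hβ T K hT hmap => ?_⟩
  have hβ0 : 0 ≤ β := le_trans (by positivity) hβ
  -- at `β = 0` the Wilson weight is `1` and `Z = 1`: `μ_{Λ,0}` is the product Haar prior
  have h0 : wilsonMeasure (d := d) (L := L) ρ 0 = Measure.pi fun _ : Edge d L => haarProbability G := by
    have hW : wilsonWeight (d := d) (L := L) ρ 0 = Measure.pi fun _ : Edge d L => haarProbability G := by
      unfold wilsonWeight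
      rw [show (fun U : GaugeConfig d L G => ENNReal.ofReal (Real.exp (-0 * wilsonAction ρ U))) = 1 from
        funext fun U => by simp, withDensity_one]
    unfold wilsonMeasure partitionFunction
    rw [hW, measure_univ, inv_one, one_smul]
  have h1 := hC L hL 0 β le_rfl hβ0 T K hT (by rwa [h0])
  have h2 : c * (2 * |C| / c) = 2 * |C| := by field_simp
  have h3 : 2 * |C| ≤ c * β := by rw [← h2]; exact mul_le_mul_of_nonneg_left hβ hc.le
  calc Real.exp (c / 2 * β) ≤ Real.exp (c * (β - 0) - C) :=
        Real.exp_le_exp.2 (by rw [sub_zero]; linarith [le_abs_self C])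
    _ ≤ K := h1

omit [SecondCountableTopology G] in
/-- **(C2a-E′) ⟹ its layer-depth form** (same `c`, `C`): apply the law to the composite of the stack, whose
Lipschitz constant is `Λ^depth` (`lipschitzWith_compLayers`), and take logarithms. [folklore] -/
theorem layerExpansionDepthBetween_of_between {d : ℕ} (h : ExactTransportExpansionBetween d N G ρ) :
    LayerExpansionDepthBetween d N G ρ := by
  obtain ⟨c, hc, C, hC⟩ := h
  refine ⟨c, hc, C, fun L _ hL β₀ β hβ₀ hβ l Λ hΛ hmap => ?_⟩
  have h1 := hC L hL β₀ β hβ₀ hβ (compLayers l) (Λ ^ l.length) (lipschitzWith_compLayers l hΛ) hmap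
  rw [NNReal.coe_pow] at h1
  have h2 := Real.log_le_log (Real.exp_pos _) h1
  rwa [Real.log_exp, Real.log_pow] at h2

end Expansion

/-! ## §4. Instances with no hypothesis left: `U(1)`, `U(N)`, `SU(N)` -/

section Instances

open scoped Matrix.Norms.Frobenius
open Literature.MathematicalPhysics.QuantumFieldTheory.UnitaryCayley (𝔾)
open Literature.MathematicalPhysics.QuantumLattice (u1Rep continuous_u1Rep unitaryFundamentalRep
  continuous_unitaryFundamentalRep fundamentalRep continuous_fundamentalRep)

/-- **(C2a-E′) for `U(1) = Circle`, `d ≥ 2`** (OURS): `Lip(T) ≥ e^{c(β-β₀)-C}` for every exact Lipschitz transport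
of the `U(1)` Wilson law at `β₀ ≥ 0` onto the one at `β ≥ β₀`, `L ≥ 2`, uniformly in `L`. [folklore] -/
theorem U1.exactTransportExpansionBetween (d : ℕ) (hd : 2 ≤ d) :
    ExactTransportExpansionBetween d 1 Circle u1Rep := by
  obtain ⟨a, ha, hlo⟩ := U1.haar_closedBall_ge'
  obtain ⟨A, _, hup⟩ := U1.haar_closedBall_le'
  exact exactTransportExpansionBetween_of_ballVolumes u1Rep d hd continuous_u1Rep U1.re_trace_u1Rep_le
    U1.neg_one_le_re_trace ⟨Circle.exp Real.pi, by rw [U1.re_trace_exp_pi]; norm_num⟩ one_pos ha hlo hup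

/-- **(C2a-E′) for `U(N)`, `N ≥ 1`, `d ≥ 2`, Hilbert–Schmidt metric** (OURS). [folklore] -/
theorem UN.exactTransportExpansionBetween (d N : ℕ) (hd : 2 ≤ d) (hN : 1 ≤ N) :
    @ExactTransportExpansionBetween d N (𝔾 N) _ Subtype.metricSpace UN.isTopologicalGroup_hs UN.compactSpace_hs _
      UN.borelSpace_hs (unitaryFundamentalRep (Fin N) ℂ) := by
  obtain ⟨a, ha, hlo⟩ := UN.haar_closedBall_ge (N := N)
  obtain ⟨A, hA, hup⟩ := UN.haar_closedBall_le (N := N)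
  have hκ : 0 < N * N := Nat.mul_pos (by omega) (by omega)
  have hnc : ∃ g : 𝔾 N, (unitaryFundamentalRep (Fin N) ℂ g).trace.re ≠ N := ⟨-1, by
    rw [UN.re_trace_neg_one]
    have : (1 : ℝ) ≤ N := by exact_mod_cast hN
    linarith⟩
  exact @exactTransportExpansionBetween_of_ballVolumes N (𝔾 N) _ Subtype.metricSpace UN.isTopologicalGroup_hs
    UN.compactSpace_hs UN.secondCountable_hs _ UN.borelSpace_hs (unitaryFundamentalRep (Fin N) ℂ) d hd
    (continuous_unitaryFundamentalRep (Fin N) ℂ) UN.re_trace_le UN.neg_le_re_trace hnc (N * N) hκ a A ha hlo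
    (fun g r hr => hup g r hr)

/-- **(C2a-E′) for `SU(N)`, `N ≥ 2`, `d ≥ 2`, Hilbert–Schmidt metric** (OURS; `SU(3)`, `d = 4` included).
[folklore] -/
theorem SUN.exactTransportExpansionBetween (d N : ℕ) (hd : 2 ≤ d) (hN : 2 ≤ N) :
    @ExactTransportExpansionBetween d N (Matrix.specialUnitaryGroup (Fin N) ℂ) _ Subtype.metricSpace
      SUN.isTopologicalGroup_hs SUN.compactSpace_hs _ SUN.borelSpace_hs (fundamentalRep (Fin N)) := by
  haveI : NeZero N := ⟨by omega⟩
  obtain ⟨a, ha, hlo⟩ := SUN.haar_closedBall_ge (N := N)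
  obtain ⟨A, hA, hup⟩ := SUN.haar_closedBall_le (N := N)
  have hκ : 0 < N * N - 1 := by
    have : 2 * 2 ≤ N * N := Nat.mul_le_mul hN hN
    omega
  have hnc : ∃ g : Matrix.specialUnitaryGroup (Fin N) ℂ, (fundamentalRep (Fin N) g).trace.re ≠ N := by
    by_contra h
    simp only [not_exists, ne_eq, not_not] at h
    obtain ⟨V, hV⟩ := SUN.exists_action_ge hN hd 1
    have hS : wilsonAction (fundamentalRep (Fin N)) V = 0 := by
      unfold wilsonAction
      exact Finset.sum_eq_zero fun p _ => by rw [h, sub_self]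
    rw [hS] at hV
    norm_num at hV
  exact @exactTransportExpansionBetween_of_ballVolumes N (Matrix.specialUnitaryGroup (Fin N) ℂ) _
    Subtype.metricSpace SUN.isTopologicalGroup_hs SUN.compactSpace_hs SUN.secondCountable_hs _ SUN.borelSpace_hs
    (fundamentalRep (Fin N)) d hd (continuous_fundamentalRep (Fin N)) (SUN.re_trace_le N) SUN.neg_le_re_trace hnc
    (N * N - 1) hκ a A ha hlo (fun g r hr => hup g r hr)

/-- **(C2a-E′-depth) for `SU(N)`, `N ≥ 2`, `d ≥ 2`** (OURS; `SU(3)`, `d = 4` included): a stack of `Λ`-Lipschitz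
layers realising `μ_{β₀} → μ_β` exactly has `depth·log Λ ≥ c(β-β₀) - C`. [folklore] -/
theorem SUN.layerExpansionDepthBetween (d N : ℕ) (hd : 2 ≤ d) (hN : 2 ≤ N) :
    @LayerExpansionDepthBetween d N (Matrix.specialUnitaryGroup (Fin N) ℂ) _ Subtype.metricSpace
      SUN.isTopologicalGroup_hs SUN.compactSpace_hs _ SUN.borelSpace_hs (fundamentalRep (Fin N)) :=
  @layerExpansionDepthBetween_of_between N (Matrix.specialUnitaryGroup (Fin N) ℂ) _ Subtype.metricSpace
    SUN.isTopologicalGroup_hs SUN.compactSpace_hs _ SUN.borelSpace_hs (fundamentalRep (Fin N)) d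
    (SUN.exactTransportExpansionBetween d N hd hN)

end Instances

end Summit.Ventures.LatticeQCDFlow.Theory2.Lattice
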